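import Summits.ABC.IUTFork.Repair.ObstructionSS18
import Summits.ABC.IUTFork.Repair.EvalInternal
import Summits.ABC.IUTFork.Repair.CandJoshi21
import Summits.ABC.IUTFork.Repair.Barrier
import HarnessLib

/-!
# IUT REPAIR branch, sub-cell B5 — ESCAPE CENSUS VI(d): the FLIP-SHELLS PROFILE — the branch's canonical candidate shapes evaluated at the
# door-(b″) model

Proofs only (D-0012; no definition, no `Prop` fact, nothing asserted about print) of the abc-iut cell's IUT REPAIR branch (REPAIR-SPEC §3 T-b
PROFILE v0.4, RULINGS #11: «every candidate whose H mentions ⟨Ind1∪Ind2⟩, a class Λ/𝒞, a transport … gets a T-b cell on the non-(Ind)-trivial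
beds»; row RP-S05 door (b″)), seat abc-iut-rp-s2 (gen 2). The bed is `ObstructionSS14` (flip shells), the model `ObstructionSS16.fSetting` with
reading `rho` and q-datum `fqK`, its consequences `ObstructionSS18` (p438460 / p438603 / p439466). This file adds NO model data: it records, one
theorem per cell, the value AT THE FLIP BED of the branch's canonical candidate shapes, so that the lead / rp-cx can fill a «FLIP» profile column
without re-deriving anything. TAKES NO SIDE on [IUTchIII] Cor. 3.12 or on any author (Mochizuki / Scholze–Stix / Joshi / Dupuy–Hilado); typed ≠
proved; instantiated ≠ endorsed; a candidate HOLDING or FAILING at a toy bed says nothing about its source.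

THE CELLS (✓ holds / ✗ fails at `fSetting`, `rho`, `fqK`):
* the bed is NON-(Ind)-TRIVIAL (`flip_not_indTrivial`: the flip family MOVES `thetaRegion3` at every label `j ≥ 1`) and S holds NON-IDENTIFIED
  (`flip_not_ansatzQReading`: abc-iut-rp-j2's `JoshiAnsatzQReading` = door (O4) «ρ qK = ρ Ψ_n» ✗ — the q-point is not the Θ-point);
* abc-iut-rp-cx's canonical internal shapes (`Repair/EvalInternal`, P7): RP-I01 `HGlue` ✗ (`flip_not_hGlue`: every column's Frobenius-like Θ-datum
  reads the Θ-point), RP-I02 `HLink` ✓ (`flip_hLink`: the flip family is the link witness), RP-I04 `HIncl` ✓ (`flip_hIncl`);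
* abc-iut-rp-j2's Joshi shapes (`Repair/CandJoshi21`): `JoshiScalingIndeterminacy` ✓ (`flip_scalingIndeterminacy`, ≡ `PilotKummerCompat`),
  `JoshiNonIsometricIndeterminacy` ✓ (`flip_nonIsometric`: the flip changes the volume of the admissible Θ-point of label 2);
* abc-iut-rp-bar's BAR-V `VolumePinned` ✗ (`flip_not_volumePinned`: `μ(ρ qK) = −1 ≠ −4 = μ(ρ Ψ)` at label 2 — consistent with
  `volumePinned_of_residual`, whose Step-(x) volume premise fails here, `ObstructionSS18.f_not_logvolInvariant`);
* the levels: C `PilotKummerCompat` ✓ (SS18), R `PilotKummerIndRelated` ✓ (SS16), region `PilotKummerCompatRegion` ✓, hull `PilotKummerCompatHull` ✓,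
  `Thm311ToCor312.Licence` ✓, `GapA3` ✓, `GapH3` ✓ (`flip_levels`) — every level of the branch's target ladder is MET at this bed, together with the
  typed Corollary (`ObstructionSS18.f_statement`).
PROFILE SENTENCE (neutral): at the FLIP bed a candidate that READS THE q-DATUM AS AN INDETERMINACY-TRANSLATE (HLink / JoshiScalingIndeterminacy /
PilotKummerCompat, and everything weaker) HOLDS together with S and the Corollary; a candidate that IDENTIFIES regions or volumes (HGlue, AnsatzQReading,
VolumePinned) FAILS; so the bed separates «transport» candidates from «identification» candidates exactly as P♮ does, but WITHOUT P♮'s departure from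
honest `j²`-scaling — its departure is the volume half of Step (x) (REPAIR-SPEC v0.6 `breaks` = «Step (x) volume clause only (door (b″), non-Haar Ism)»).
[cite: ScholzeStix2018, §2.2 pp. 9–10] [claim: Mochizuki2012, status: disputed] Standard axioms only; nothing asserted.
-/

noncomputable section

open Set

namespace Summit.ABC.IUTFork.Repair.ObstructionSS20

open Thm311 Cor312 Cor312Vol Cor312.Checks Cor312.IdentifiedNonVacuity Literature.IUT.LogThetaLattice ObstructionSS14 ObstructionSS16
  ObstructionSS18

/-! ## 1. Non-(Ind)-trivial; S non-identified -/

/-- **The flip bed is NOT (Ind)-trivial** (abc-iut-w5-d068's inline class `hfix` of `Cor312PinnedIndTrivial`): the flip family moves the (Ind3)-enlarged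
Θ-region at every label `j ≥ 1` (Θ-point ↦ q-point). [folklore] -/
theorem flip_not_indTrivial : ¬ ∀ Φ ∈ Setting.indGroup fFull.toLatticeSituation.toSituation, ∀ (j : toyIndex.Label) (vQ : toyIndex.VQ),
    Φ j vQ '' fSetting.thetaRegion3 j vQ = fSetting.thetaRegion3 j vQ := fun h => by
  have h1 := h flipFam flipFam_mem_closure (Setting.labelSucc (⟨0, by decide⟩ : Fin toyIndex.lstar)) ()
  rw [fSetting_thetaRegion3, if_neg (Setting.labelSucc_ne_zero _), Set.image_singleton, flipFam_aVec, Set.singleton_eq_singleton_iff] at h1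
  exact aVec_ne_bVec _ _ h1.symm

/-- **S holds NON-IDENTIFIED**: abc-iut-rp-j2's `JoshiAnsatzQReading` (= door (O4) «ρ qK = ρ Ψ_n», the identity-indeterminacy reading) FAILS — at
label `1` the q-point is not the Θ-point. [folklore] -/
theorem flip_not_ansatzQReading : ¬ JoshiAnsatzQReading fFull.toLatticeSituation fSetting rho fqK := fun h => by
  have h1 := h (Setting.labelSucc (⟨0, by decide⟩ : Fin toyIndex.lstar)) ()
  have hΨ : (fFull.D fSetting.n).Ψ = fPsi := rfl
  rw [hΨ, rho_fqK, rho_fPsi, if_neg (Setting.labelSucc_ne_zero _), if_neg (Setting.labelSucc_ne_zero _), Set.singleton_eq_singleton_iff] at h1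
  exact aVec_ne_bVec _ _ h1.symm

/-! ## 2. The canonical internal shapes of `Repair/EvalInternal` (RP-I01 / I02 / I04) -/

/-- **RP-I01 `HGlue` (link-faithful glue (b2′)) FAILS**: every column's Frobenius-like Θ-datum is the Θ-datum, whose region at label `1` is the
Θ-point, not the q-point. [folklore] -/
theorem flip_not_hGlue : ¬ EvalInternal.HGlue fFull.toLatticeSituation fSetting rho fqK := by
  rintro ⟨m₀, h⟩
  have h1 := h (Setting.labelSucc (⟨0, by decide⟩ : Fin toyIndex.lstar)) ()
  have hΨ : (fFull.col (fSetting.n - 1)).frobΨ m₀ = fPsi := rfl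
  rw [hΨ, rho_fqK, rho_fPsi, if_neg (Setting.labelSucc_ne_zero _), if_neg (Setting.labelSucc_ne_zero _), Set.singleton_eq_singleton_iff] at h1
  exact aVec_ne_bVec _ _ h1.symm

/-- **RP-I02 `HLink` (datum-level transport (L)+(LI)) HOLDS**: the flip family is the link witness. [folklore] -/
theorem flip_hLink : EvalInternal.HLink fFull.toLatticeSituation fSetting fqK :=
  (EvalInternal.hLink_iff_pilotKummerCompat fFull.toLatticeSituation fSetting fqK (f_kummerB 0)).2 f_pilotKummerCompat

/-- **RP-I04 `HIncl` (inclusion form) HOLDS.** [folklore] -/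
theorem flip_hIncl : EvalInternal.HIncl fFull.toLatticeSituation fSetting fqK :=
  EvalInternal.hIncl_of_pilotKummerCompat fFull.toLatticeSituation fSetting fqK f_pilotKummerCompat

/-! ## 3. The Joshi shapes of `Repair/CandJoshi21` (RP-J21-2 / J21-5) -/

/-- **`JoshiScalingIndeterminacy` HOLDS** (it is `PilotKummerCompat` with `m = 0`, Thm. 3.11 (ii)(b) by `rfl` here). [folklore] -/
theorem flip_scalingIndeterminacy : JoshiScalingIndeterminacy fFull.toLatticeSituation fSetting fqK := by
  obtain ⟨Φ, hΦ, m, hm⟩ := f_pilotKummerCompat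
  exact ⟨Φ, hΦ, hm⟩

/-- **`JoshiNonIsometricIndeterminacy` HOLDS**: the flip family changes the volume of the admissible Θ-point of label `2` (`−4 ↦ −1`). [folklore] -/
theorem flip_nonIsometric : JoshiNonIsometricIndeterminacy fFull.toLatticeSituation.toSituation fSetting.n := by
  refine ⟨flipFam, flipFam_mem_closure, Setting.labelSucc (⟨1, by decide⟩ : Fin toyIndex.lstar), (), {aVec _ ()},
    adm_singleton _ _ (aVec_mem_tShell _ _), ?_⟩
  rw [Set.image_singleton, flipFam_aVec]
  show vol _ () {bVec _ ()} ≠ vol (Setting.labelSucc (⟨1, by decide⟩ : Fin toyIndex.lstar)) () {aVec _ ()}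
  rw [vol_bVec, vol_aVec_two]
  norm_num

/-! ## 4. BAR-V `VolumePinned` -/

/-- **abc-iut-rp-bar's `VolumePinned` (BAR-V) FAILS**: at label `2` the q-region has volume `−1`, the Θ-region `−4` — consistent with
`Repair.volumePinned_of_residual`, whose Step-(x) volume premise fails here (`ObstructionSS18.f_not_logvolInvariant`). [folklore] -/
theorem flip_not_volumePinned : ¬ VolumePinned fFull.toLatticeSituation fSetting rho fqK := fun h => by
  have h2 := h (Setting.labelSucc (⟨1, by decide⟩ : Fin toyIndex.lstar)) ()
  have hΨ : (fFull.D fSetting.n).Ψ = fPsi := rfl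
  rw [hΨ, rho_fqK, rho_fPsi, if_neg (Setting.labelSucc_ne_zero _), if_neg (Setting.labelSucc_ne_zero _)] at h2
  have h2' : vol _ () {bVec _ ()} = vol (Setting.labelSucc (⟨1, by decide⟩ : Fin toyIndex.lstar)) () {aVec _ ()} := h2
  rw [vol_bVec, vol_aVec_two] at h2'
  norm_num at h2'

/-- … while at label `1` the two volumes AGREE (`−1 = −1`): the failure sits at the honest label `2` only. [folklore] -/
theorem flip_volumes_agree_at_one :
    (fFull.D fSetting.n).logvol _ () (rho fqK (Setting.labelSucc (⟨0, by decide⟩ : Fin toyIndex.lstar)) ()) =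
      (fFull.D fSetting.n).logvol _ () (rho (fFull.D fSetting.n).Ψ (Setting.labelSucc (⟨0, by decide⟩ : Fin toyIndex.lstar)) ()) := by
  have hΨ : (fFull.D fSetting.n).Ψ = fPsi := rfl
  rw [hΨ, rho_fqK, rho_fPsi, if_neg (Setting.labelSucc_ne_zero _)]
  show vol _ () {bVec _ ()} = vol (Setting.labelSucc (⟨0, by decide⟩ : Fin toyIndex.lstar)) () {aVec _ ()}
  rw [vol_bVec, vol_aVec, show ((Setting.labelSucc (⟨0, by decide⟩ : Fin toyIndex.lstar) : toyIndex.Label) : ℕ) = 1 by decide]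
  norm_num

/-! ## 5. The levels of the target ladder: all met -/

/-- **Every level of the branch's target ladder is MET at the flip bed**: C (`PilotKummerCompat`), R (S), region, hull, licence, `GapA3`, `GapH3`.
[claim: Mochizuki2012, status: disputed] -/
theorem flip_levels :
    PilotKummerCompat fFull.toLatticeSituation fSetting fqK ∧ PilotKummerIndRelated fFull.toLatticeSituation fSetting rho fqK ∧
      PilotKummerCompatRegion fFull.toLatticeSituation fSetting rho fqK ∧ PilotKummerCompatHull fFull.toLatticeSituation fSetting rho fqK ∧
      Thm311ToCor312.Licence fSetting ∧ GapA3 fFull.toLatticeSituation fSetting rho fqK ∧ GapH3 fFull.toLatticeSituation fSetting rho fqK := by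
  have hreg : PilotKummerCompatRegion fFull.toLatticeSituation fSetting rho fqK :=
    pilotKummerCompatRegion_of_pilotKummerCompat fFull.toLatticeSituation fSetting rho fqK f_thetaPinned.1 f_pilotKummerCompat
  have hA3 : GapA3 fFull.toLatticeSituation fSetting rho fqK :=
    (gapA3_iff fFull.toLatticeSituation fSetting rho fqK (f_kummerB 0)).2 fun _ => f_S
  exact ⟨f_pilotKummerCompat, f_S, hreg, pilotKummerCompatHull_of_region fFull.toLatticeSituation fSetting rho fqK f_thetaPinned hreg,
    gapH3_of_gapA3 fFull.toLatticeSituation fSetting rho fqK hA3 f_pinnedRegions3, hA3, gapH3_of_gapA3 fFull.toLatticeSituation fSetting rho fqK hA3⟩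

/-! ## 6. The profile in one theorem -/

/-- **THE FLIP PROFILE**: transport-type candidates HOLD (HLink, HIncl, JoshiScalingIndeterminacy, JoshiNonIsometricIndeterminacy, all levels C/R/region/
hull/licence), identification-type candidates FAIL (HGlue, JoshiAnsatzQReading, VolumePinned), the bed is non-(Ind)-trivial, and the typed Corollary
holds (`ObstructionSS18.f_statement`). [claim: Mochizuki2012, status: disputed] -/
theorem flip_profile :
    EvalInternal.HLink fFull.toLatticeSituation fSetting fqK ∧ EvalInternal.HIncl fFull.toLatticeSituation fSetting fqK ∧
      JoshiScalingIndeterminacy fFull.toLatticeSituation fSetting fqK ∧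
      JoshiNonIsometricIndeterminacy fFull.toLatticeSituation.toSituation fSetting.n ∧
      ¬ EvalInternal.HGlue fFull.toLatticeSituation fSetting rho fqK ∧ ¬ JoshiAnsatzQReading fFull.toLatticeSituation fSetting rho fqK ∧
      ¬ VolumePinned fFull.toLatticeSituation fSetting rho fqK ∧ fSetting.Statement :=
  ⟨flip_hLink, flip_hIncl, flip_scalingIndeterminacy, flip_nonIsometric, flip_not_hGlue, flip_not_ansatzQReading, flip_not_volumePinned,
    f_statement⟩

end Summit.ABC.IUTFork.Repair.ObstructionSS20

end
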